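import Mathlib
import Literature.Probability.Percolation.PercolationProofs
import Literature.Probability.Percolation.KozmaNitzanPinning
import Literature.Probability.LatticeModels.ProdBernoulliIndependence
import Literature.Probability.LatticeModels.ProdBernoulliRecolour

/-!
# Crux `PercNearOneGluing.NoHeavyLowerTail` (stmt-CriticalPhenomena-4575), line
`bhk-superadditivity-thinning` — stub `starDisintegration` (star disintegration of an event)

Helper file for the crux skeleton (lead prover-line-stmt-CriticalPhenomena-4575-c3-0): proves
exactly the registered stub signature `starDisintegration`; lands with
`--supports stmt-CriticalPhenomena-4575`.

## Content

Bond percolation on `Fin n` with independent edges, `μ = prodBernoulli w` on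
`BondConfig (Fin n) = Set (Sym2 (Fin n))`.  Fix an observer `o`, let `Fo` be the pairs at `o`
(`univ.filter (o ∈ ·)`) and `Ho = univ \ Fo` the pairs off `o`.  For EVERY event `E`,

`μ(E) = Σ_{η ⊆ Ho} μ([η]_{Ho}) · Σ_{ξ ⊆ Fo} (∏_{e ∈ ξ} w e)(∏_{e ∈ Fo \ ξ} (1 - w e)) · 1{ξ ∪ η ∈ E}`,

i.e. the product measure disintegrates into the law of the configuration `η` off `o` times the law
of `o`'s star pattern `ξ` (bookkeeping identity "product measure = (coins at `o`) ⊗ (configuration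
off `o`)" used by the percolation star corollary of the line).

## Proof

(1) Every event on the finite index type is determined by `univ`, so by the tree's cylinder
decomposition `prodBernoulli_real_eq_sum_localCylinder`,
`μ(E) = Σ_{T ⊆ univ, T ∈ E} μ([T]_{univ})`.
(2) For `ξ ⊆ Fo`, `η ⊆ Ho`: `[ξ ∪ η]_{univ} = [η]_{Ho} ∩ [ξ]_{Fo}`, the two cylinders are determined
by the disjoint finsets `Ho`, `Fo`, hence independent
(`prodBernoulli_real_inter_of_determinedBy_disjoint`), and
`μ([ξ]_{Fo}) = (∏_{ξ} w)(∏_{Fo \ ξ} (1 - w))` (`prodBernoulli_real_localCylinder`).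
(3) Reindex the sum over `T ⊆ univ = Fo ∪ Ho` by the bijection `T ↦ (T ∩ Fo, T ∩ Ho)`,
`(ξ, η) ↦ ξ ∪ η` (folklore `Σ_{T ⊆ A ∪ B} f T = Σ_{ξ ⊆ A} Σ_{η ⊆ B} f (ξ ∪ η)` for disjoint
`A, B`), swap the two sums and distribute.
-/

namespace Summit.CriticalPhenomena.PercolationContinuityZ3.Theorems

open MeasureTheory
open scoped Classical
open Literature.Probability.LatticeModels Literature.Probability.Percolation

/-- Sums over the subsets of a disjoint union `T ∪ T' = U` are double sums over pairs of subsets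
(`S ↦ (S ∩ T, S ∩ T')`, inverse `(S₀, S₁) ↦ S₀ ∪ S₁`). [folklore] -/
-- adapted from Literature/Probability/LatticeModels/CurrentsAvoidMixing.lean
-- (`sum_powerset_union_of_disjoint`), with the union abstracted to `U`.
private theorem starDisintegration_sum_powerset {α M : Type*} [DecidableEq α] [AddCommMonoid M]
    {T T' U : Finset α} (h : Disjoint T T') (hU : T ∪ T' = U) (f : Finset α → M) :
    ∑ S ∈ U.powerset, f S = ∑ S₀ ∈ T.powerset, ∑ S₁ ∈ T'.powerset, f (S₀ ∪ S₁) := by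
  subst hU
  rw [← Finset.sum_product' (β := M) T.powerset T'.powerset (fun S₀ S₁ => f (S₀ ∪ S₁))]
  refine (Finset.sum_nbij' (M := M) (fun p => p.1 ∪ p.2) (fun S => (S ∩ T, S ∩ T')) ?_ ?_ ?_ ?_ ?_).symm
  · intro p hp
    rw [Finset.mem_product, Finset.mem_powerset, Finset.mem_powerset] at hp
    exact Finset.mem_powerset.2 (Finset.union_subset_union hp.1 hp.2)
  · intro S _
    rw [Finset.mem_product, Finset.mem_powerset, Finset.mem_powerset]
    exact ⟨Finset.inter_subset_right, Finset.inter_subset_right⟩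
  · intro p hp
    rw [Finset.mem_product, Finset.mem_powerset, Finset.mem_powerset] at hp
    have h1 : (p.1 ∪ p.2) ∩ T = p.1 := by
      rw [Finset.union_inter_distrib_right, Finset.inter_eq_left.2 hp.1,
        Finset.disjoint_iff_inter_eq_empty.1 (h.symm.mono_left hp.2), Finset.union_empty]
    have h2 : (p.1 ∪ p.2) ∩ T' = p.2 := by
      rw [Finset.union_inter_distrib_right, Finset.inter_eq_left.2 hp.2,
        Finset.disjoint_iff_inter_eq_empty.1 (h.mono_left hp.1), Finset.empty_union]
    rw [h1, h2]
  · intro S hS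
    rw [Finset.mem_powerset] at hS
    change S ∩ T ∪ S ∩ T' = S
    rw [← Finset.inter_union_distrib_left, Finset.inter_eq_left.2 hS]
  · intro p _; rfl

/-- Every event of configurations on a finite index type is determined by all coordinates.
[folklore] -/
private theorem starDisintegration_determinedBy_univ {n : ℕ} (B : Set (BondConfig (Fin n))) :
    DeterminedBy B (↑(Finset.univ : Finset (Sym2 (Fin n))) : Set (Sym2 (Fin n))) := by
  rw [Finset.coe_univ, determinedBy_iff]
  intro ω ω' h
  rw [Set.inter_univ, Set.inter_univ] at h
  rw [h]

/-- Cylinder probabilities with a finset pattern `ξ ⊆ K`: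
`μ([ξ]_K) = (∏_{e ∈ ξ} w e) · ∏_{e ∈ K \ ξ} (1 - w e)`. [folklore] -/
private theorem starDisintegration_real_localCylinder {n : ℕ} (w : Sym2 (Fin n) → unitInterval)
    {K ξ : Finset (Sym2 (Fin n))} (hξ : ξ ⊆ K) :
    (prodBernoulli w).real (localCylinder (↑K : Set (Sym2 (Fin n))) ↑ξ) =
      (∏ e ∈ ξ, ((w e : unitInterval) : ℝ)) * ∏ e ∈ K \ ξ, (1 - ((w e : unitInterval) : ℝ)) := by
  rw [prodBernoulli_real_localCylinder]
  congr 1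
  · refine Finset.prod_congr ?_ fun _ _ => rfl
    ext e
    simp only [Finset.mem_filter, Finset.mem_coe]
    exact ⟨fun h => h.2, fun h => ⟨hξ h, h⟩⟩
  · refine Finset.prod_congr ?_ fun _ _ => rfl
    ext e
    simp only [Finset.mem_filter, Finset.mem_coe, Finset.mem_sdiff]

/-- **Independence of the star and its complement**: for disjoint finsets `Fo`, `Ho` covering all
pairs and patterns `ξ ⊆ Fo`, `η ⊆ Ho`,
`μ([ξ ∪ η]_{univ}) = μ([η]_{Ho}) · (∏_{ξ} w)(∏_{Fo \ ξ} (1 - w))`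
(the full cylinder is the intersection of the two partial cylinders, which are determined by
disjoint coordinate sets). [folklore] -/
private theorem starDisintegration_factor {n : ℕ} (w : Sym2 (Fin n) → unitInterval)
    {Fo Ho ξ η : Finset (Sym2 (Fin n))} (hd : Disjoint Fo Ho)
    (hU : Fo ∪ Ho = (Finset.univ : Finset (Sym2 (Fin n)))) (hξ : ξ ⊆ Fo) (hη : η ⊆ Ho) :
    (prodBernoulli w).real (localCylinder (↑(Finset.univ : Finset (Sym2 (Fin n))) : Set (Sym2 (Fin n)))
        ((↑ξ : Set (Sym2 (Fin n))) ∪ ↑η)) =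
      (prodBernoulli w).real (localCylinder (↑Ho : Set (Sym2 (Fin n))) ↑η) *
        ((∏ e ∈ ξ, ((w e : unitInterval) : ℝ)) * ∏ e ∈ Fo \ ξ, (1 - ((w e : unitInterval) : ℝ))) := by
  have hcyl : localCylinder (↑(Finset.univ : Finset (Sym2 (Fin n))) : Set (Sym2 (Fin n)))
        ((↑ξ : Set (Sym2 (Fin n))) ∪ ↑η) =
      localCylinder (↑Ho : Set (Sym2 (Fin n))) ↑η ∩ localCylinder (↑Fo : Set (Sym2 (Fin n))) ↑ξ := by
    ext ω
    simp only [localCylinder, Set.mem_setOf_eq, Set.mem_inter_iff, Finset.coe_univ, Set.mem_univ,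
      true_implies, Set.mem_union, Finset.mem_coe]
    constructor
    · intro h
      refine ⟨fun i hi => (h i).trans ⟨?_, Or.inr⟩, fun i hi => (h i).trans ⟨?_, Or.inl⟩⟩
      · rintro (hiξ | hiη)
        · exact absurd hi (Finset.disjoint_left.1 hd (hξ hiξ))
        · exact hiη
      · rintro (hiξ | hiη)
        · exact hiξ
        · exact absurd (hη hiη) (Finset.disjoint_left.1 hd hi)
    · rintro ⟨hH, hF⟩ i
      have hi : i ∈ Fo ∪ Ho := by rw [hU]; exact Finset.mem_univ i
      rcases Finset.mem_union.1 hi with hiF | hiH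
      · rw [hF i hiF]
        exact ⟨Or.inl, fun h' => h'.elim id fun hiη => absurd (hη hiη) (Finset.disjoint_left.1 hd hiF)⟩
      · rw [hH i hiH]
        exact ⟨Or.inr, fun h' => h'.elim (fun hiξ => absurd hiH (Finset.disjoint_left.1 hd (hξ hiξ))) id⟩
  rw [hcyl, prodBernoulli_real_inter_of_determinedBy_disjoint w hd.symm
      (Literature.Probability.Percolation.determinedBy_localCylinder _ _)
      (Literature.Probability.Percolation.determinedBy_localCylinder _ _)
      (measurableSet_localCylinder Ho.finite_toSet.countable _)
      (measurableSet_localCylinder Fo.finite_toSet.countable _),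
    starDisintegration_real_localCylinder w hξ]

/-- **Star disintegration** (stub `starDisintegration` of stmt-CriticalPhenomena-4575).  Under the
product measure `μ = prodBernoulli w` on the bond configurations of `Fin n`, with `Fo` the pairs at
the observer `o` and `Ho = univ \ Fo` the pairs off `o`, every event `E` disintegrates as
`μ(E) = Σ_{η ⊆ Ho} μ([η]_{Ho}) · Σ_{ξ ⊆ Fo} (∏_{e ∈ ξ} w e)(∏_{e ∈ Fo \ ξ} (1 - w e)) · 1{ξ ∪ η ∈ E}`:
the configuration off `o` and the star pattern at `o` are independent, the latter with the explicit
coin-pattern law.  Proof: cylinder decomposition over `univ`, independence of cylinders over the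
disjoint finsets `Ho`, `Fo`, the cylinder formula, and the reindexing `T ↦ (T ∩ Fo, T ∩ Ho)`. -/
theorem starDisintegration : ∀ (n : ℕ) (w : Sym2 (Fin n) → unitInterval) (o : Fin n) (E : Set (Literature.Probability.Percolation.BondConfig (Fin n))), (Literature.Probability.LatticeModels.prodBernoulli w).real E = ∑ η ∈ ((Finset.univ : Finset (Sym2 (Fin n))) \ (Finset.univ : Finset (Sym2 (Fin n))).filter (fun e => o ∈ e)).powerset, (Literature.Probability.LatticeModels.prodBernoulli w).real (Literature.Probability.Percolation.localCylinder (↑((Finset.univ : Finset (Sym2 (Fin n))) \ (Finset.univ : Finset (Sym2 (Fin n))).filter (fun e => o ∈ e)) : Set (Sym2 (Fin n))) (↑η : Set (Sym2 (Fin n)))) * ∑ ξ ∈ ((Finset.univ : Finset (Sym2 (Fin n))).filter (fun e => o ∈ e)).powerset, ((∏ e ∈ ξ, ((w e : unitInterval) : ℝ)) * ∏ e ∈ ((Finset.univ : Finset (Sym2 (Fin n))).filter (fun e => o ∈ e)) \ ξ, (1 - ((w e : unitInterval) : ℝ))) * (if ((↑ξ ∪ ↑η : Set (Sym2 (Fin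 n))) ∈ E) then (1 : ℝ) else 0) := by
  intro n w o E
  set Fo : Finset (Sym2 (Fin n)) := (Finset.univ : Finset (Sym2 (Fin n))).filter (fun e => o ∈ e)
    with hFo
  set Ho : Finset (Sym2 (Fin n)) := (Finset.univ : Finset (Sym2 (Fin n))) \ Fo with hHo
  have hd : Disjoint Fo Ho := Finset.disjoint_sdiff
  have hU : Fo ∪ Ho = (Finset.univ : Finset (Sym2 (Fin n))) :=
    Finset.union_sdiff_of_subset (Finset.subset_univ _)
  rw [prodBernoulli_real_eq_sum_localCylinder w Finset.univ (starDisintegration_determinedBy_univ E),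
    Finset.sum_filter, starDisintegration_sum_powerset hd hU, Finset.sum_comm]
  refine Finset.sum_congr rfl fun η hη => ?_
  rw [Finset.mul_sum]
  refine Finset.sum_congr rfl fun ξ hξ => ?_
  rw [Finset.coe_union]
  by_cases hE : ((↑ξ : Set (Sym2 (Fin n))) ∪ ↑η) ∈ E
  · rw [if_pos hE, if_pos hE, mul_one]
    exact starDisintegration_factor w hd hU (Finset.mem_powerset.1 hξ) (Finset.mem_powerset.1 hη)
  · rw [if_neg hE, if_neg hE, mul_zero, mul_zero]

end Summit.CriticalPhenomena.PercolationContinuityZ3.Theorems
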